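import Literature.MathematicalPhysics.QuantumFieldTheory.Balaban1983to89.Node00.CanonicalTransportOfRecord
import Literature.MathematicalPhysics.QuantumFieldTheory.Balaban1983to89.T3OrbitAverage

/-!
# NODE 00 (YM-PLAN Track A) — ORBIT AVERAGES AND THE TRANSFORM OF RECORD IN A.E. CURRENCY: Fubini null sets for the orbit maps, «an a.e.-invariant function equals its
# orbit average a.e.» (globally and ON a gauge-stable set), locality of the kernel transform along the fibres, and [I] p. 254's push-forward step for densities that are
# lift-invariant only a.e., or only over a gauge-stable set of coarse fields

Cell `pub-ymgap`, NODE 00 territory, typed by WIDTH SEAT `pub-ymgap-dag-n09-w3` (g0; HUMAN RULING D-0149; plan g78 YMPLAN-G78-WORDS-2, cure option (b) of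
`HOME/pub-ymgap-dag-n09-w3/N09-ITEM3-MEMO.md`).  THEOREMS ONLY, def-free, sorry-free — the kernel lemmas the OFFERED token `TinvOfRecord` (`Node00/InvariantTransportOfRecord.lean`,
definition lane) rests on, split out so that they land in the proof lane and are citable by every transport-level consumer.  [I] = [Balaban1987RG1], [III] = [Balaban1988Convergent].
Imports node00-def-K0e's FILE 6 `CanonicalTransportOfRecord` (through it def-B ∕ def-T's `transportOfRecord`, `isRT_transportOfRecord`, `avOfRecord_*`) and ym3-torus's `T3OrbitAverage`
(`haarTransf P j` = the Haar probability of the gauge group `Site P j → SU(N)`, `orbAvg f V = ∫ f(V^γ) dγ`, `orbAvg_gaugeAct` — REUSED, nothing re-declared).  KNIT-BY-NAME;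
count-neutral; NOTHING of Bałaban's asserted.

CONTENT.  §1 ORBIT AVERAGES IN A.E. CURRENCY: `orbAvg_eq_of_gaugeInvariant`; `measurable_gaugeAct_uncurry`; **`ae_haarTransf_gaugeAct_mem_null`** (for a `dU`-null measurable `N₀`,
a.e. `V` has `V^γ ∉ N₀` for Haar-a.e. `γ` — Fubini on the orbit map, each section `V ↦ V^γ` preserving `dU`); **`orbAvg_ae_eq_of_ae_invariant`** (a measurable `f` with `f(·^γ) = f`
a.e. for every `γ` equals `orbAvg f` a.e.); `orbAvg_congr_ae`; `orbAvg_ae_eq_of_ae_invariant'`.  §2 THE TRANSFORM OF RECORD: `isRT_mul_comp_avg`; **`transportOfRecord_mul_indicator_ae_eq`**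
(LOCALITY ALONG THE FIBRES: `T(ρ·𝟙_E∘Ū) = 𝟙_E·Tρ` a.e.); `ae_liftInvariant_mul_indicator`; **`isRT_comp_gaugeAct_of_eventuallyEq`** ([I] p. 254's key step for a density lift-invariant only
`dU`-a.e.; the Summits-side twin is dag-n09-w3's `…SupportAE.isRT_comp_gaugeAct_of_ae`); **`transportOfRecord_gaugeAct_ae_eq_on`** (`Tρ` a.e. gauge invariant ON a measurable gauge-stable
`E` over which `ρ` is a.e.-lift-invariant); `orbAvg_ae_eq_on_of_ae_invariant_on(')`.  §3 K0e's §4 LOCALISED to an open stable set `O` on which the a.e.-class is invariant: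
`HasContVersionOn.preimage_of_measurePreserving_on`, `mapsTo_regSet_inter_of_on`, **`canonVersion_comp_eqOn_inter_of_on`** (the canonical version is invariant at every point of
`regSet ∩ O`), and at the record **`TcanOfRecord_gaugeAct_of_mem_regSet_inter_of_on`** — the Stage-13 token IS gauge invariant on `regSetOfRecord ∩ O` for `ρ` lift-invariant a.e. over
`Ū⁻¹ O` only (the junk corner OFF `O` plays no role).

HONEST FRAMING: kernel-checked measure-theoretic bookkeeping (Mathlib + the tree's `IsRT` uniqueness `ae_eq_of_isRT`); nothing of Bałaban's asserted; no estimate; no record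
predicate defined or re-pointed; counts unmoved (typed 28∕28 · discharged 5∕27); one finite four-torus programme at fixed `ε = L^{−K}` — NOT continuum ∕ ℝ⁴ ∕ OS ∕ mass gap ∕
Clay.  No `sorry`, no `axiom`, no `instance`, no `notation`, no `def`.
-/

noncomputable section

open MeasureTheory Set
open scoped BigOperators

namespace Literature.MathematicalPhysics.QuantumFieldTheory.Balaban1983to89.Node00

open _root_.Topology
open T4Continuum (T4Family)
open B12RTGaugeInvariance254 (LiftInvariant liftTransf invTransf invTransf_liftTransf avg_gaugeAct_liftTransf measurePreserving_gaugeAct measurable_gaugeAct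
  gaugeAct_inv_gaugeAct gaugeAct_gaugeAct_inv isRT_comp_gaugeAct ae_eq_of_isRT integrable_comp_gaugeAct)
open B12ContinuousTransportInvariance (continuous_gaugeAct)
open T3OrbitAverage (haarTransf orbAvg orbAvg_gaugeAct)
open T4AveragingDisintegration (integrable_kernelTransport)

/-! ## §1. The orbit average over the gauge group (ym3-torus `T3OrbitAverage.orbAvg` ∕ `haarTransf`, REUSED) in a.e. currency: Fubini null sets, versions -/

section OrbitAE

variable {N : ℕ} [NeZero N] {P : Params} {j : ℕ}

/-- On a function that is ALREADY gauge invariant the orbit average does nothing (pointwise): `orbAvg f = f` (the integrand is the constant `f V` and the Haar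
measure of the gauge group is a probability). [cite: Balaban1985Averaging, (12) p.19 (bookkeeping)] -/
theorem orbAvg_eq_of_gaugeInvariant {f : GaugeField P j (SU N) → ℝ} (hf : GaugeField.GaugeInvariant f) : orbAvg f = f := by
  funext V
  unfold orbAvg
  simp_rw [hf _ V]
  simp

/-- The action map `(γ, V) ↦ V^γ` is jointly measurable (bondwise products and inverses; no topology used). [cite: Balaban1985Averaging, (8) p.18 (bookkeeping)] -/
theorem measurable_gaugeAct_uncurry :
    Measurable fun p : (Site P j → SU N) × GaugeField P j (SU N) => GaugeField.gaugeAct p.1 p.2 := by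
  refine measurable_pi_lambda _ fun b => ?_
  exact ((((measurable_pi_apply b.src).comp measurable_fst).mul ((measurable_pi_apply b).comp measurable_snd)).mul
    ((measurable_pi_apply b.tgt).comp measurable_fst).inv)

/-- **FUBINI NULL-SET LEMMA FOR THE ORBIT MAPS**: if `N₀` is a measurable `dU`-null set of step-`j` fields, then for `dU`-a.e. `V` the set of gauge transformations `γ` with
`V^γ ∈ N₀` is Haar-null — the preimage of `N₀` under `(γ, V) ↦ V^γ` is product-null since every section `V ↦ V^γ` preserves `dU` (`measurePreserving_gaugeAct`), and a
product-null set has a.e.-null sections in the other order (Mathlib `Measure.measure_prod_null`, `Measure.measure_ae_null_of_prod_null`, `Measure.prod_swap`).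
[cite: Balaban1987RG1, (0.13) p.254 and (0.15) p.255 (bookkeeping)] -/
theorem ae_haarTransf_gaugeAct_mem_null {N₀ : Set (GaugeField P j (SU N))} (hN : MeasurableSet N₀) (hN0 : fieldMeasure P j (SU N) N₀ = 0) :
    ∀ᵐ V ∂(fieldMeasure P j (SU N)), (haarTransf (N := N) P j) {γ : Site P j → SU N | GaugeField.gaugeAct γ V ∈ N₀} = 0 := by
  set S : Set ((Site P j → SU N) × GaugeField P j (SU N)) := {p | GaugeField.gaugeAct p.1 p.2 ∈ N₀} with hS
  have hSm : MeasurableSet S := measurable_gaugeAct_uncurry hN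
  have hsec : ((haarTransf (N := N) P j).prod (fieldMeasure P j (SU N))) S = 0 := by
    refine (Measure.measure_prod_null hSm).2 (Filter.Eventually.of_forall fun γ => ?_)
    show (fieldMeasure P j (SU N)) (GaugeField.gaugeAct γ ⁻¹' N₀) = 0
    rw [← Measure.map_apply (measurable_gaugeAct γ) hN, (measurePreserving_gaugeAct γ).map_eq, hN0]
  have hswap : ((fieldMeasure P j (SU N)).prod (haarTransf (N := N) P j)) (Prod.swap ⁻¹' S) = 0 := by
    rw [← Measure.map_apply measurable_swap hSm, Measure.prod_swap]; exact hsec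
  filter_upwards [Measure.measure_ae_null_of_prod_null hswap] with V hV
  exact hV

/-- **A MEASURABLE A.E.-INVARIANT FUNCTION EQUALS ITS ORBIT AVERAGE A.E.**: if `f` is measurable and `f(V^γ) = f(V)` for `dU`-a.e. `V`, every `γ`, then `orbAvg f = f` `dU`-a.e.
(the set `{(γ, V) : f(V^γ) ≠ f(V)}` is measurable with null `γ`-sections, hence for a.e. `V` its `V`-section is null, where the Haar integral of `γ ↦ f(V^γ)` is that of the
constant `f(V)`). [cite: Balaban1987RG1, (0.13) p.254 (bookkeeping)] -/
theorem orbAvg_ae_eq_of_ae_invariant {f : GaugeField P j (SU N) → ℝ} (hf : Measurable f)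
    (hinv : ∀ γ : Site P j → SU N, (fun V => f (GaugeField.gaugeAct γ V)) =ᵐ[fieldMeasure P j (SU N)] f) :
    orbAvg f =ᵐ[fieldMeasure P j (SU N)] f := by
  set S : Set ((Site P j → SU N) × GaugeField P j (SU N)) := {p | f (GaugeField.gaugeAct p.1 p.2) ≠ f p.2} with hS
  have hSm : MeasurableSet S := by
    have h1 : Measurable fun p : (Site P j → SU N) × GaugeField P j (SU N) => f (GaugeField.gaugeAct p.1 p.2) := hf.comp measurable_gaugeAct_uncurry
    have h2 : Measurable fun p : (Site P j → SU N) × GaugeField P j (SU N) => f p.2 := hf.comp measurable_snd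
    exact (measurableSet_eq_fun h1 h2).compl
  have hsec : ((haarTransf (N := N) P j).prod (fieldMeasure P j (SU N))) S = 0 := by
    refine (Measure.measure_prod_null hSm).2 (Filter.Eventually.of_forall fun γ => ?_)
    show (fieldMeasure P j (SU N)) {V | f (GaugeField.gaugeAct γ V) ≠ f V} = 0
    have hγ := hinv γ
    rw [Filter.EventuallyEq, ae_iff] at hγ; exact hγ
  have hswap : ((fieldMeasure P j (SU N)).prod (haarTransf (N := N) P j)) (Prod.swap ⁻¹' S) = 0 := by
    rw [← Measure.map_apply measurable_swap hSm, Measure.prod_swap]; exact hsec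
  have h := Measure.measure_ae_null_of_prod_null hswap
  filter_upwards [h] with V hV
  have hV0 : (haarTransf (N := N) P j) {γ : Site P j → SU N | ¬ (f (GaugeField.gaugeAct γ V) = f V)} = 0 := hV
  have hV' : ∀ᵐ γ ∂(haarTransf (N := N) P j), γ ∉ {γ : Site P j → SU N | ¬ (f (GaugeField.gaugeAct γ V) = f V)} := measure_eq_zero_iff_ae_notMem.1 hV0
  have hV'' : (fun γ : Site P j → SU N => f (GaugeField.gaugeAct γ V)) =ᵐ[haarTransf (N := N) P j] fun _ => f V := by
    filter_upwards [hV'] with γ hγ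
    simpa only [mem_setOf_eq, not_not] using hγ
  unfold orbAvg
  rw [integral_congr_ae hV'']
  simp

/-- **THE ORBIT AVERAGE RESPECTS A.E.-CLASSES**: `f = f′` `dU`-a.e. ⇒ `orbAvg f = orbAvg f′` `dU`-a.e. (a.e. `V` has `V^γ` outside the exceptional null set for a.e. `γ`,
`ae_haarTransf_gaugeAct_mem_null`). [cite: Balaban1987RG1, (0.13) p.254 (bookkeeping)] -/
theorem orbAvg_congr_ae {f f' : GaugeField P j (SU N) → ℝ} (h : f =ᵐ[fieldMeasure P j (SU N)] f') :
    orbAvg f =ᵐ[fieldMeasure P j (SU N)] orbAvg f' := by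
  have h0 : fieldMeasure P j (SU N) {V | ¬ (f V = f' V)} = 0 := by rw [Filter.EventuallyEq, ae_iff] at h; exact h
  obtain ⟨N₀, hNsub, hNm, hN0⟩ := exists_measurable_superset_of_null h0
  filter_upwards [ae_haarTransf_gaugeAct_mem_null hNm hN0] with V hV
  unfold orbAvg
  refine integral_congr_ae ?_
  have hV' : ∀ᵐ γ ∂(haarTransf (N := N) P j), γ ∉ {γ : Site P j → SU N | GaugeField.gaugeAct γ V ∈ N₀} := measure_eq_zero_iff_ae_notMem.1 hV
  filter_upwards [hV'] with γ hγ
  by_contra hne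
  exact hγ (hNsub hne)

/-- **AN A.E.-STRONGLY-MEASURABLE A.E.-INVARIANT FUNCTION EQUALS ITS ORBIT AVERAGE A.E.** (the previous two lemmas through a measurable modification, which inherits the
a.e.-invariance because each `V ↦ V^γ` preserves `dU`). [cite: Balaban1987RG1, (0.13) p.254 (bookkeeping)] -/
theorem orbAvg_ae_eq_of_ae_invariant' {f : GaugeField P j (SU N) → ℝ} (hf : AEStronglyMeasurable f (fieldMeasure P j (SU N)))
    (hinv : ∀ γ : Site P j → SU N, (fun V => f (GaugeField.gaugeAct γ V)) =ᵐ[fieldMeasure P j (SU N)] f) :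
    orbAvg f =ᵐ[fieldMeasure P j (SU N)] f := by
  have hmk := hf.ae_eq_mk
  have hinv' : ∀ γ : Site P j → SU N, (fun V => hf.mk f (GaugeField.gaugeAct γ V)) =ᵐ[fieldMeasure P j (SU N)] hf.mk f := by
    intro γ
    have h1 : (fun V => hf.mk f (GaugeField.gaugeAct γ V)) =ᵐ[fieldMeasure P j (SU N)] fun V => f (GaugeField.gaugeAct γ V) :=
      (measurePreserving_gaugeAct γ).quasiMeasurePreserving.ae_eq_comp hmk.symm
    exact h1.trans ((hinv γ).trans hmk)
  exact (orbAvg_congr_ae hmk).trans ((orbAvg_ae_eq_of_ae_invariant hf.stronglyMeasurable_mk.measurable hinv').trans hmk.symm)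

end OrbitAE

/-! ## §2. LOCALITY of the transform of record along the fibres, and its a.e. gauge invariance ON a gauge-stable set of coarse fields over which `ρ` is
a.e.-lift-invariant (the push-forward argument of [I] p. 254 run on the cut density `ρ·𝟙_E∘Ū`) -/

section Local

variable {F : T4Family} {N : ℕ} [NeZero N]

/-- `IsRT` is compatible with multiplication by a bounded measurable function of the COARSE field pulled back along the averaging: if `ρ′` is a renormalisation image of `ρ`,
then `V ↦ ρ′(V)·φ(V)` is one of `U ↦ ρ(U)·φ(Ū)` (test the defining identity against `φ·f`). [cite: Balaban1985Averaging, (10) p.19 (bookkeeping)] -/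
theorem isRT_mul_comp_avg {P : Params} {j : ℕ} {avg : GaugeField P j (SU N) → GaugeField P (j + 1) (SU N)} {ρ : Density P j (SU N)}
    {ρ' : Density P (j + 1) (SU N)} (h : IsRT avg ρ ρ') {φ : GaugeField P (j + 1) (SU N) → ℝ} (hφ : Measurable φ) {C : ℝ} (hC : ∀ V, |φ V| ≤ C) :
    IsRT avg (fun U => ρ U * φ (avg U)) (fun V => ρ' V * φ V) := by
  intro f hf hbd
  obtain ⟨D, hD⟩ := hbd
  have key := h (fun V => φ V * f V) (hφ.mul hf)
    ⟨C * D, fun V => by rw [abs_mul]; exact mul_le_mul (hC V) (hD V) (abs_nonneg _) ((abs_nonneg _).trans (hC V))⟩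
  simp only [mul_assoc]
  exact key

/-- **LOCALITY OF THE TRANSFORM OF RECORD ALONG THE FIBRES**: cutting a fine density to the fibres over a measurable set `E` of coarse fields cuts its transform to `E`:
`T(ρ·𝟙_E∘Ū) = 𝟙_E·Tρ` `dV`-a.e. (`k < K`, `ρ` integrable; both sides are renormalisation images of the same density, a.e. uniqueness `ae_eq_of_isRT`).
[cite: Balaban1988Convergent, (3.1) p.264; Balaban1985Averaging, (10) p.19 (bookkeeping)] -/
theorem transportOfRecord_mul_indicator_ae_eq {K k : ℕ} (hk : k < K) {ρ : Density (F.P K) k (SU N)} (hρ : Integrable ρ (fieldMeasure (F.P K) k (SU N)))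
    {E : Set (GaugeField (F.P K) (k + 1) (SU N))} (hE : MeasurableSet E) :
    transportOfRecord F N K k (fun U => ρ U * E.indicator (fun _ => (1 : ℝ)) ((avOfRecord F N K k).avg U)) =ᵐ[fieldMeasure (F.P K) (k + 1) (SU N)]
      fun V => transportOfRecord F N K k ρ V * E.indicator (fun _ => (1 : ℝ)) V := by
  have hφ : Measurable (E.indicator fun _ : GaugeField (F.P K) (k + 1) (SU N) => (1 : ℝ)) := measurable_const.indicator hE
  have hφb : ∀ V, |E.indicator (fun _ : GaugeField (F.P K) (k + 1) (SU N) => (1 : ℝ)) V| ≤ 1 := fun V => by by_cases hV : V ∈ E <;> simp [hV]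
  have hρE : Integrable (fun U => ρ U * E.indicator (fun _ => (1 : ℝ)) ((avOfRecord F N K k).avg U)) (fieldMeasure (F.P K) k (SU N)) :=
    hρ.mul_bdd ((hφ.comp (avOfRecord_measurable F N K k)).aestronglyMeasurable) (Filter.Eventually.of_forall fun U => by rw [Real.norm_eq_abs]; exact hφb _)
  have hT : Integrable (transportOfRecord F N K k ρ) (fieldMeasure (F.P K) (k + 1) (SU N)) :=
    integrable_kernelTransport (fieldMeasure (F.P K) k (SU N)) (fieldMeasure (F.P K) (k + 1) (SU N)) (avOfRecord_measurable F N K k)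
      (avOfRecord_haarAC F N K k hk) hρ
  have h1 := isRT_transportOfRecord F N K k hk _ hρE
  have h2 := isRT_mul_comp_avg (isRT_transportOfRecord F N K k hk ρ hρ) hφ hφb
  have hi1 : Integrable (transportOfRecord F N K k (fun U => ρ U * E.indicator (fun _ => (1 : ℝ)) ((avOfRecord F N K k).avg U)))
      (fieldMeasure (F.P K) (k + 1) (SU N)) :=
    integrable_kernelTransport (fieldMeasure (F.P K) k (SU N)) (fieldMeasure (F.P K) (k + 1) (SU N)) (avOfRecord_measurable F N K k)
      (avOfRecord_haarAC F N K k hk) hρE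
  have hi2 : Integrable (fun V => transportOfRecord F N K k ρ V * E.indicator (fun _ => (1 : ℝ)) V) (fieldMeasure (F.P K) (k + 1) (SU N)) :=
    hT.mul_bdd hφ.aestronglyMeasurable (Filter.Eventually.of_forall fun V => by rw [Real.norm_eq_abs]; exact hφb _)
  exact ae_eq_of_isRT h1 h2 hi1 hi2

/-- **CUTTING TO THE FIBRES OVER A GAUGE-STABLE SET PRESERVES A.E.-LIFT-INVARIANCE**: if `E` is stable under every coarse gauge transformation and `ρ(U^{ṽ}) = ρ(U)` for
`dU`-a.e. `U` with `Ū ∈ E`, then `ρ·𝟙_E∘Ū` is a.e.-lift-invariant outright (`Ū(U^{ṽ}) = (ŪU)^v`, `Averaging.covariant`). [cite: Balaban1987RG1, (0.13) p.254 and (2.1) p.265 (bookkeeping)] -/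
theorem ae_liftInvariant_mul_indicator {K k : ℕ} (hk : k < K) {ρ : Density (F.P K) k (SU N)} {E : Set (GaugeField (F.P K) (k + 1) (SU N))}
    (hEst : ∀ (v : GaugeTransf (F.P K) (k + 1) (SU N)) (V : GaugeField (F.P K) (k + 1) (SU N)), GaugeField.gaugeAct v V ∈ E ↔ V ∈ E)
    (hinv : ∀ v : GaugeTransf (F.P K) (k + 1) (SU N), ∀ᵐ U ∂(fieldMeasure (F.P K) k (SU N)),
      (avOfRecord F N K k).avg U ∈ E → ρ (GaugeField.gaugeAct (liftTransf v) U) = ρ U) (v : GaugeTransf (F.P K) (k + 1) (SU N)) :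
    (fun U => ρ (GaugeField.gaugeAct (liftTransf v) U) * E.indicator (fun _ => (1 : ℝ)) ((avOfRecord F N K k).avg (GaugeField.gaugeAct (liftTransf v) U)))
      =ᵐ[fieldMeasure (F.P K) k (SU N)] fun U => ρ U * E.indicator (fun _ => (1 : ℝ)) ((avOfRecord F N K k).avg U) := by
  have hj : k + 1 ≤ (F.P K).m + (F.P K).K := by simp only [T4Continuum.T4Family.P_K]; omega
  filter_upwards [hinv v] with U hU
  rw [avg_gaugeAct_liftTransf hj (avOfRecord F N K k) v U]
  by_cases hmem : (avOfRecord F N K k).avg U ∈ E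
  · have hmem' : GaugeField.gaugeAct v ((avOfRecord F N K k).avg U) ∈ E := (hEst v _).2 hmem
    rw [Set.indicator_of_mem hmem', Set.indicator_of_mem hmem, hU hmem]
  · have hmem' : GaugeField.gaugeAct v ((avOfRecord F N K k).avg U) ∉ E := fun h => hmem ((hEst v _).1 h)
    rw [Set.indicator_of_notMem hmem', Set.indicator_of_notMem hmem, mul_zero, mul_zero]

/-- **p. 254's KEY STEP IN A.E. CURRENCY** (Literature-side statement; the Summits-side twin is dag-n09-w3's `…SupportAE.isRT_comp_gaugeAct_of_ae`): a renormalisation image of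
an a.e.-lift-invariant `ρ` stays one after a coarse gauge transformation of its argument. [cite: Balaban1987RG1, (0.13) p.254 and (2.1) p.265; Balaban1985Averaging, (10)–(11) p.19] -/
theorem isRT_comp_gaugeAct_of_eventuallyEq {P : Params} {j : ℕ} (hj : j + 1 ≤ P.m + P.K) (av : Averaging P j (SU N)) {ρ : Density P j (SU N)}
    {ρ' : Density P (j + 1) (SU N)} (h : IsRT av.avg ρ ρ')
    (hρ : ∀ v : GaugeTransf P (j + 1) (SU N), (fun U => ρ (GaugeField.gaugeAct (liftTransf v) U)) =ᵐ[fieldMeasure P j (SU N)] ρ)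
    (v : GaugeTransf P (j + 1) (SU N)) : IsRT av.avg ρ (fun V => ρ' (GaugeField.gaugeAct v V)) := by
  intro f hf hbd
  obtain ⟨C, hC⟩ := hbd
  have hf' : Measurable (fun V : GaugeField P (j + 1) (SU N) => f (GaugeField.gaugeAct (invTransf v) V)) := hf.comp (measurable_gaugeAct _)
  have hbd' : ∃ C : ℝ, ∀ V : GaugeField P (j + 1) (SU N), |f (GaugeField.gaugeAct (invTransf v) V)| ≤ C := ⟨C, fun V => hC _⟩
  have key := h _ hf' hbd'
  calc ∫ V, ρ' (GaugeField.gaugeAct v V) * f V ∂(fieldMeasure P (j + 1) (SU N))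
      = ∫ V, ρ' (GaugeField.gaugeAct v V) * f (GaugeField.gaugeAct (invTransf v) (GaugeField.gaugeAct v V)) ∂(fieldMeasure P (j + 1) (SU N)) := by
        simp_rw [gaugeAct_inv_gaugeAct]
    _ = ∫ V, ρ' V * f (GaugeField.gaugeAct (invTransf v) V) ∂(fieldMeasure P (j + 1) (SU N)) :=
        B12FaddeevPopov016.integral_comp_gaugeAct v (fun V => ρ' V * f (GaugeField.gaugeAct (invTransf v) V))
    _ = ∫ U, ρ U * f (GaugeField.gaugeAct (invTransf v) (av.avg U)) ∂(fieldMeasure P j (SU N)) := key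
    _ = ∫ U, ρ U * f (av.avg (GaugeField.gaugeAct (liftTransf (invTransf v)) U)) ∂(fieldMeasure P j (SU N)) := by
        simp_rw [avg_gaugeAct_liftTransf hj av (invTransf v)]
    _ = ∫ U, ρ (GaugeField.gaugeAct (liftTransf v) U) *
          f (av.avg (GaugeField.gaugeAct (liftTransf (invTransf v)) (GaugeField.gaugeAct (liftTransf v) U))) ∂(fieldMeasure P j (SU N)) :=
        (B12FaddeevPopov016.integral_comp_gaugeAct (liftTransf v)
          (fun U => ρ U * f (av.avg (GaugeField.gaugeAct (liftTransf (invTransf v)) U)))).symm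
    _ = ∫ U, ρ U * f (av.avg U) ∂(fieldMeasure P j (SU N)) := by
        refine integral_congr_ae ?_
        filter_upwards [hρ v] with U hU
        rw [hU, ← invTransf_liftTransf, gaugeAct_inv_gaugeAct]

/-- **THE TRANSFORM OF RECORD IS A.E. GAUGE INVARIANT ON A GAUGE-STABLE SET OVER WHICH `ρ` IS A.E.-LIFT-INVARIANT** (`k < K`, `ρ` integrable, `E` measurable): for every coarse
`v`, `dV`-a.e. `V ∈ E` has `(Tρ)(V^v) = (Tρ)(V)` — the global push-forward argument run on the cut density `ρ·𝟙_E∘Ū`, plus locality. [cite: Balaban1987RG1, (0.13) p.254 and (2.1) p.265] -/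
theorem transportOfRecord_gaugeAct_ae_eq_on {K k : ℕ} (hk : k < K) {ρ : Density (F.P K) k (SU N)} (hρ : Integrable ρ (fieldMeasure (F.P K) k (SU N)))
    {E : Set (GaugeField (F.P K) (k + 1) (SU N))} (hE : MeasurableSet E)
    (hEst : ∀ (v : GaugeTransf (F.P K) (k + 1) (SU N)) (V : GaugeField (F.P K) (k + 1) (SU N)), GaugeField.gaugeAct v V ∈ E ↔ V ∈ E)
    (hinv : ∀ v : GaugeTransf (F.P K) (k + 1) (SU N), ∀ᵐ U ∂(fieldMeasure (F.P K) k (SU N)),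
      (avOfRecord F N K k).avg U ∈ E → ρ (GaugeField.gaugeAct (liftTransf v) U) = ρ U) (v : GaugeTransf (F.P K) (k + 1) (SU N)) :
    ∀ᵐ V ∂(fieldMeasure (F.P K) (k + 1) (SU N)), V ∈ E → transportOfRecord F N K k ρ (GaugeField.gaugeAct v V) = transportOfRecord F N K k ρ V := by
  have hj : k + 1 ≤ (F.P K).m + (F.P K).K := by simp only [T4Continuum.T4Family.P_K]; omega
  set ρE : Density (F.P K) k (SU N) := fun U => ρ U * E.indicator (fun _ => (1 : ℝ)) ((avOfRecord F N K k).avg U) with hρEdef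
  have hφ : Measurable (E.indicator fun _ : GaugeField (F.P K) (k + 1) (SU N) => (1 : ℝ)) := measurable_const.indicator hE
  have hφb : ∀ V, |E.indicator (fun _ : GaugeField (F.P K) (k + 1) (SU N) => (1 : ℝ)) V| ≤ 1 := fun V => by by_cases hV : V ∈ E <;> simp [hV]
  have hρE : Integrable ρE (fieldMeasure (F.P K) k (SU N)) :=
    hρ.mul_bdd ((hφ.comp (avOfRecord_measurable F N K k)).aestronglyMeasurable) (Filter.Eventually.of_forall fun U => by rw [Real.norm_eq_abs]; exact hφb _)
  have hRT := isRT_transportOfRecord F N K k hk ρE hρE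
  have hiT : Integrable (transportOfRecord F N K k ρE) (fieldMeasure (F.P K) (k + 1) (SU N)) :=
    integrable_kernelTransport (fieldMeasure (F.P K) k (SU N)) (fieldMeasure (F.P K) (k + 1) (SU N)) (avOfRecord_measurable F N K k)
      (avOfRecord_haarAC F N K k hk) hρE
  -- the cut density is a.e.-lift-invariant outright, so its transform is a.e. invariant
  have hlift : ∀ w : GaugeTransf (F.P K) (k + 1) (SU N), (fun U => ρE (GaugeField.gaugeAct (liftTransf w) U)) =ᵐ[fieldMeasure (F.P K) k (SU N)] ρE :=
    fun w => ae_liftInvariant_mul_indicator hk hEst hinv w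
  have hTinv : (fun V => transportOfRecord F N K k ρE (GaugeField.gaugeAct v V)) =ᵐ[fieldMeasure (F.P K) (k + 1) (SU N)] transportOfRecord F N K k ρE :=
    ae_eq_of_isRT (isRT_comp_gaugeAct_of_eventuallyEq hj (avOfRecord F N K k) hRT hlift v) hRT (integrable_comp_gaugeAct hiT v) hiT
  -- locality on both sides
  have hloc := transportOfRecord_mul_indicator_ae_eq hk hρ hE
  have hloc' : (fun V => transportOfRecord F N K k ρE (GaugeField.gaugeAct v V)) =ᵐ[fieldMeasure (F.P K) (k + 1) (SU N)]
      fun V => transportOfRecord F N K k ρ (GaugeField.gaugeAct v V) * E.indicator (fun _ => (1 : ℝ)) (GaugeField.gaugeAct v V) :=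
    (measurePreserving_gaugeAct v).quasiMeasurePreserving.ae_eq_comp hloc
  filter_upwards [hTinv, hloc, hloc'] with V h1 h2 h3 hV
  have hV' : GaugeField.gaugeAct v V ∈ E := (hEst v V).2 hV
  have e := (h3.symm.trans h1).trans h2
  simp only [Set.indicator_of_mem hV, Set.indicator_of_mem hV', mul_one] at e
  exact e

/-- **RESTRICTED ORBIT LEMMA**: a measurable `f` that is a.e.-invariant ON a measurable gauge-stable set `E` equals its orbit average a.e. ON `E` (§1's global lemma applied to the
cut function `𝟙_E·f`, which is a.e.-invariant outright; on `E` the two orbit averages agree pointwise since orbits of `E` stay in `E`). [cite: Balaban1987RG1, (0.13) p.254 (bookkeeping)] -/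
theorem orbAvg_ae_eq_on_of_ae_invariant_on {P : Params} {j : ℕ} {f : GaugeField P j (SU N) → ℝ} (hf : Measurable f) {E : Set (GaugeField P j (SU N))}
    (hE : MeasurableSet E) (hEst : ∀ (γ : Site P j → SU N) (V : GaugeField P j (SU N)), GaugeField.gaugeAct γ V ∈ E ↔ V ∈ E)
    (hinv : ∀ γ : Site P j → SU N, ∀ᵐ V ∂(fieldMeasure P j (SU N)), V ∈ E → f (GaugeField.gaugeAct γ V) = f V) :
    ∀ᵐ V ∂(fieldMeasure P j (SU N)), V ∈ E → orbAvg f V = f V := by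
  set fE : GaugeField P j (SU N) → ℝ := E.indicator f with hfE
  have hfEm : Measurable fE := hf.indicator hE
  have hfEinv : ∀ γ : Site P j → SU N, (fun V => fE (GaugeField.gaugeAct γ V)) =ᵐ[fieldMeasure P j (SU N)] fE := by
    intro γ
    filter_upwards [hinv γ] with V hV
    by_cases hmem : V ∈ E
    · have hmem' : GaugeField.gaugeAct γ V ∈ E := (hEst γ V).2 hmem
      simp only [hfE, Set.indicator_of_mem hmem', Set.indicator_of_mem hmem, hV hmem]
    · have hmem' : GaugeField.gaugeAct γ V ∉ E := fun h => hmem ((hEst γ V).1 h)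
      simp only [hfE, Set.indicator_of_notMem hmem', Set.indicator_of_notMem hmem]
  filter_upwards [orbAvg_ae_eq_of_ae_invariant hfEm hfEinv] with V hV hmem
  have h1 : orbAvg f V = orbAvg fE V := by
    unfold orbAvg
    refine integral_congr_ae (Filter.Eventually.of_forall fun γ => ?_)
    have hmem' : GaugeField.gaugeAct γ V ∈ E := (hEst γ V).2 hmem
    simp only [hfE, Set.indicator_of_mem hmem']
  rw [h1, hV, hfE, Set.indicator_of_mem hmem]

/-- … the same for an a.e.-strongly-measurable `f` (through a measurable modification). [cite: Balaban1987RG1, (0.13) p.254 (bookkeeping)] -/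
theorem orbAvg_ae_eq_on_of_ae_invariant_on' {P : Params} {j : ℕ} {f : GaugeField P j (SU N) → ℝ} (hf : AEStronglyMeasurable f (fieldMeasure P j (SU N)))
    {E : Set (GaugeField P j (SU N))} (hE : MeasurableSet E)
    (hEst : ∀ (γ : Site P j → SU N) (V : GaugeField P j (SU N)), GaugeField.gaugeAct γ V ∈ E ↔ V ∈ E)
    (hinv : ∀ γ : Site P j → SU N, ∀ᵐ V ∂(fieldMeasure P j (SU N)), V ∈ E → f (GaugeField.gaugeAct γ V) = f V) :
    ∀ᵐ V ∂(fieldMeasure P j (SU N)), V ∈ E → orbAvg f V = f V := by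
  have hmk := hf.ae_eq_mk
  have hinv' : ∀ γ : Site P j → SU N, ∀ᵐ V ∂(fieldMeasure P j (SU N)), V ∈ E → hf.mk f (GaugeField.gaugeAct γ V) = hf.mk f V := by
    intro γ
    have h1 : (fun V => hf.mk f (GaugeField.gaugeAct γ V)) =ᵐ[fieldMeasure P j (SU N)] fun V => f (GaugeField.gaugeAct γ V) :=
      (measurePreserving_gaugeAct γ).quasiMeasurePreserving.ae_eq_comp hmk.symm
    filter_upwards [h1, hinv γ, hmk] with V e1 e2 e3 hV
    rw [e1, e2 hV, e3]
  filter_upwards [orbAvg_congr_ae (N := N) hmk, orbAvg_ae_eq_on_of_ae_invariant_on hf.stronglyMeasurable_mk.measurable hE hEst hinv', hmk] with V e1 e2 e3 hV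
  rw [e1, e2 hV, ← e3]

end Local

/-! ## §3. K0e's §4 LOCALISED: the maximal regular set and the canonical version under measure-preserving homeomorphisms that leave the a.e.-class invariant ONLY ON AN
OPEN STABLE SET `O` — `regSet ∩ O` is mapped to itself and the canonical version is invariant at every point of it; at the record: `TcanOfRecord` is gauge invariant on
`regSetOfRecord ∩ O` for a density lift-invariant a.e. over `Ū⁻¹ O` only -/

section LocalCanon

variable {α : Type*} [TopologicalSpace α] [MeasurableSpace α] {μ : Measure α} {f : α → ℝ} {Φ Ψ : α → α}

/-- **A VERSION NEAR `x ∈ O` PUSHES FORWARD ALONG `Φ`** when the a.e.-class of `f` is `Φ`-invariant ON the open stable set `O` only: if `f` has a version continuous on an open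
`U ∋ x`, `U ⊆ O`, then it has one on the open set `Ψ ⁻¹' U ∋ Φ x` (`Ψ = Φ⁻¹` continuous and measure preserving; the version is `g ∘ Ψ`, and `f ∘ Ψ = f` a.e. on `Ψ ⁻¹' O` from
`f ∘ Φ = f` a.e. on `O`). [cite: Balaban1987RG1, (0.13) p.254 and p.263 (bookkeeping)] -/
theorem HasContVersionOn.preimage_of_measurePreserving_on [OpensMeasurableSpace α] (hΨc : Continuous Ψ) (hΨ : MeasurePreserving Ψ μ μ) (hΦΨ : ∀ x, Φ (Ψ x) = x)
    {O : Set α} (hO : MeasurableSet O) (hinv : f ∘ Φ =ᵐ[μ.restrict O] f) {U : Set α} (hU : IsOpen U) (hUO : U ⊆ O) (h : HasContVersionOn μ f U) :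
    HasContVersionOn μ f (Ψ ⁻¹' U) := by
  obtain ⟨g, hg, hae⟩ := h
  refine ⟨g ∘ Ψ, hg.comp hΨc.continuousOn fun x hx => hx, ?_⟩
  have h1 : g ∘ Ψ =ᵐ[μ.restrict (Ψ ⁻¹' U)] f ∘ Ψ :=
    ((hΨ.restrict_preimage hU.measurableSet).quasiMeasurePreserving).ae_eq_comp hae
  -- `f ∘ Ψ = f` a.e. on `Ψ ⁻¹' O`: compose `f ∘ Φ = f` (a.e. on `O`) with `Ψ`
  have h2 : (f ∘ Φ) ∘ Ψ =ᵐ[μ.restrict (Ψ ⁻¹' O)] f ∘ Ψ :=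
    ((hΨ.restrict_preimage hO).quasiMeasurePreserving).ae_eq_comp hinv
  have h3 : (f ∘ Φ) ∘ Ψ = f := funext fun x => by simp only [Function.comp_apply, hΦΨ]
  rw [h3] at h2
  have h4 : f =ᵐ[μ.restrict (Ψ ⁻¹' U)] f ∘ Ψ := ae_restrict_of_ae_restrict_of_subset (preimage_mono hUO) h2
  exact h1.trans h4.symm

/-- **`Φ` MAPS `regSet μ f ∩ O` INTO ITSELF** when `O` is open and `Φ`∕`Ψ`-stable and the a.e.-class of `f` is `Φ`-invariant on `O`. [cite: Balaban1987RG1, (0.13) p.254 (bookkeeping)] -/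
theorem mapsTo_regSet_inter_of_on [OpensMeasurableSpace α] (hΨc : Continuous Ψ) (hΨ : MeasurePreserving Ψ μ μ) (hΨΦ : ∀ x, Ψ (Φ x) = x) (hΦΨ : ∀ x, Φ (Ψ x) = x)
    {O : Set α} (hOo : IsOpen O) (hΦO : MapsTo Φ O O) (hinv : f ∘ Φ =ᵐ[μ.restrict O] f) :
    MapsTo Φ (regSet μ f ∩ O) (regSet μ f ∩ O) := by
  intro x hx
  refine ⟨?_, hΦO hx.2⟩
  obtain ⟨U, hU, hxU, hV⟩ := mem_regSet_iff.1 hx.1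
  refine mem_regSet_iff.2 ⟨Ψ ⁻¹' (U ∩ O), (hU.inter hOo).preimage hΨc, ?_, ?_⟩
  · show Ψ (Φ x) ∈ U ∩ O
    rw [hΨΦ]; exact ⟨hxU, hx.2⟩
  · exact HasContVersionOn.preimage_of_measurePreserving_on hΨc hΨ hΦΨ hOo.measurableSet hinv (hU.inter hOo) inter_subset_right
      (let ⟨g, hg, hae⟩ := hV; ⟨g, hg.mono inter_subset_left, ae_restrict_of_ae_restrict_of_subset inter_subset_left hae⟩)

/-- **THE CANONICAL VERSION IS INVARIANT AT EVERY POINT OF `regSet μ f ∩ O`** (second-countable `α`, open-positive `μ`): for an open stable `O` on which `f ∘ Φ = f` a.e., with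
`Φ`∕`Ψ` mutually inverse continuous measure-preserving maps — determinacy on the open set `regSet ∩ O` (`Measure.eqOn_open_of_ae_eq`).  K0e's `canonVersion_comp_eqOn` is the case
`O = univ`. [cite: Balaban1987RG1, (0.13) p.254 and p.263 (bookkeeping)] -/
theorem canonVersion_comp_eqOn_inter_of_on [SecondCountableTopology α] [OpensMeasurableSpace α] [μ.IsOpenPosMeasure] (hΦc : Continuous Φ) (hΨc : Continuous Ψ)
    (hΦ : MeasurePreserving Φ μ μ) (hΨ : MeasurePreserving Ψ μ μ) (hΨΦ : ∀ x, Ψ (Φ x) = x) (hΦΨ : ∀ x, Φ (Ψ x) = x)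
    {O : Set α} (hOo : IsOpen O) (hΦO : MapsTo Φ O O) (hinv : f ∘ Φ =ᵐ[μ.restrict O] f) :
    EqOn (canonVersion μ f ∘ Φ) (canonVersion μ f) (regSet μ f ∩ O) := by
  have hR : IsOpen (regSet μ f ∩ O) := isOpen_regSet.inter hOo
  have hmaps := mapsTo_regSet_inter_of_on hΨc hΨ hΨΦ hΦΨ hOo hΦO hinv
  have hc : ContinuousOn (canonVersion μ f ∘ Φ) (regSet μ f ∩ O) :=
    (continuousOn_canonVersion.mono inter_subset_left).comp hΦc.continuousOn hmaps
  have hc' : ContinuousOn (canonVersion μ f) (regSet μ f ∩ O) := continuousOn_canonVersion.mono inter_subset_left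
  -- a.e. on `regSet ∩ O`: `canon ∘ Φ = f ∘ Φ = f = canon`
  have h1 : canonVersion μ f ∘ Φ =ᵐ[μ] f ∘ Φ := hΦ.quasiMeasurePreserving.ae_eq_comp canonVersion_ae_eq
  have h2 : f ∘ Φ =ᵐ[μ.restrict (regSet μ f ∩ O)] f := ae_restrict_of_ae_restrict_of_subset inter_subset_right hinv
  have h3 : canonVersion μ f ∘ Φ =ᵐ[μ.restrict (regSet μ f ∩ O)] f ∘ Φ := ae_restrict_of_ae h1
  have h4 : canonVersion μ f =ᵐ[μ.restrict (regSet μ f ∩ O)] f := ae_restrict_of_ae canonVersion_ae_eq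
  have hae : canonVersion μ f ∘ Φ =ᵐ[μ.restrict (regSet μ f ∩ O)] canonVersion μ f := (h3.trans h2).trans h4.symm
  exact Measure.eqOn_open_of_ae_eq hae hR hc hc'

end LocalCanon

section LocalRecord

variable {F : T4Family} {N : ℕ} [NeZero N]

/-- **THE CANONICAL-VERSION TRANSPORT IS GAUGE INVARIANT ON `regSetOfRecord ∩ O`** for an OPEN gauge-stable measurable set `O` of coarse fields over which `ρ` is a.e.-lift-invariant
(`k < K`, `ρ` integrable): `TcanOfRecord K k ρ (V^v) = TcanOfRecord K k ρ V` for every coarse `v` and every `V ∈ regSetOfRecord K k ρ ∩ O` — K0e's `TcanOfRecord_gaugeAct_of_mem_regSet`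
with the lift-invariance of `ρ` needed only over `Ū⁻¹ O` (§2's `transportOfRecord_gaugeAct_ae_eq_on` + §3's localised determinacy).  The junk corner of the record's objects
OFF `O` plays no role. [cite: Balaban1987RG1, (0.13) p.254, p.259 and p.263] -/
theorem TcanOfRecord_gaugeAct_of_mem_regSet_inter_of_on {K k : ℕ} (hk : k < K) {ρ : Density (F.P K) k (SU N)} (hρ : Integrable ρ (fieldMeasure (F.P K) k (SU N)))
    {O : Set (GaugeField (F.P K) (k + 1) (SU N))} (hOo : IsOpen (X := PBond (F.P K) (k + 1) → SU N) O)
    (hOst : ∀ (v : GaugeTransf (F.P K) (k + 1) (SU N)) (V : GaugeField (F.P K) (k + 1) (SU N)), GaugeField.gaugeAct v V ∈ O ↔ V ∈ O)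
    (hinv : ∀ v : GaugeTransf (F.P K) (k + 1) (SU N), ∀ᵐ U ∂(fieldMeasure (F.P K) k (SU N)),
      (avOfRecord F N K k).avg U ∈ O → ρ (GaugeField.gaugeAct (liftTransf v) U) = ρ U)
    (v : GaugeTransf (F.P K) (k + 1) (SU N)) {V : PBond (F.P K) (k + 1) → SU N} (hV : V ∈ regSetOfRecord F N K k ρ ∩ O) :
    TcanOfRecord F N K k ρ (GaugeField.gaugeAct v V) = TcanOfRecord F N K k ρ V := by
  haveI := isOpenPosMeasure_piHaar_SUN N (F.P K) (k + 1)
  have hOm : MeasurableSet O := hOo.measurableSet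
  have hΦc : Continuous (X := PBond (F.P K) (k + 1) → SU N) (Y := PBond (F.P K) (k + 1) → SU N) (GaugeField.gaugeAct v) :=
    continuous_gaugeAct v
  have hΨc : Continuous (X := PBond (F.P K) (k + 1) → SU N) (Y := PBond (F.P K) (k + 1) → SU N) (GaugeField.gaugeAct (invTransf v)) :=
    continuous_gaugeAct (invTransf v)
  have hae := transportOfRecord_gaugeAct_ae_eq_on hk hρ hOm hOst hinv v
  have hinv' : (fun V : PBond (F.P K) (k + 1) → SU N => transportOfRecord F N K k ρ V) ∘ GaugeField.gaugeAct v
      =ᵐ[(piHaar (F.P K) (k + 1) (SU N)).restrict O] fun V => transportOfRecord F N K k ρ V :=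
    (ae_restrict_iff' (μ := piHaar (F.P K) (k + 1) (SU N)) hOm).2 hae
  exact canonVersion_comp_eqOn_inter_of_on (μ := piHaar (F.P K) (k + 1) (SU N)) (f := fun V => transportOfRecord F N K k ρ V)
    hΦc hΨc (measurePreserving_gaugeAct v) (measurePreserving_gaugeAct (invTransf v)) (gaugeAct_inv_gaugeAct v) (gaugeAct_gaugeAct_inv v)
    hOo (fun W hW => (hOst v W).2 hW) hinv' hV

end LocalRecord

end Literature.MathematicalPhysics.QuantumFieldTheory.Balaban1983to89.Node00

end
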